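import Mathlib
import HarnessLib
import Summits.Ventures.LatticeQCDFlow.Scoring.ReversibleVariationalVariance

/-!
# The HOLDING (rejection) floor: a reversible sampler that stays put with probability at least `r` at
# every state has `C(1) ≥ (2r − 1) · Var_π f` and `σ²_f ≥ r/(1−r) · Var_π f` — `τ_int,f ≥ r/(2(1−r))` — for
# EVERY bounded observable

HONEST FRAMING: exact (Metropolis-corrected) sampling algorithms for lattice gauge theory;
figures of merit are autocorrelation/cost numbers at stated couplings and volumes; no
continuum-physics claim.

Venture `LatticeQCDFlow` (cell pub-lqcd), topic `Scoring`; FANOUT row 8 (`s0-cpn-nemc`, GEN-23).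
NEW WORK of the cell, not a published result; no definition is introduced; nothing is cited as a
fact.  Setting: a Markov kernel `κ` on a space with measurable singletons, `π` an invariant probability
law, `f` bounded measurable, `f̄ = f − πf`, `Var_π f = ∫ f̄² dπ`; the holding probability `κ(x, {x})`
(for a Metropolis–Hastings / HMC update: at least the rejection probability at `x`).  Two steps.
(1) INVARIANCE ONLY: the Dirichlet form `𝓔(f̄) = ⟨f̄, f̄ − kop κ f̄⟩_π = ½ ∫∫ (f̄ y − f̄ x)² κ(x,dy) π(dx)`
(`Scoring/ReversibleVariationalVariance.kopDirichlet_eq_half_meanSqJump`) satisfies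
`𝓔(f̄) ≤ 2 ∫ f̄(x)² κ(x, {x}ᶜ) π(dx)` — the integrand vanishes on the diagonal, `(a − b)² ≤ 2a² + 2b²`,
and the `f̄(y)²` half is `∫ kop κ (f̄²) dπ − ∫ f̄² κ(·,{·}) dπ = ∫ f̄² κ(·,{·}ᶜ) dπ` by invariance; so a
UNIFORM holding bound `κ(x, {x}) ≥ r` gives `𝓔(f̄) ≤ 2(1 − r) Var_π f`, i.e. the lag-one
autocovariance obeys **`C(1) ≥ (2r − 1) Var_π f`**.  (2) REVERSIBLE + geometric envelope: the slow-mode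
bound of `Scoring/ReversibleVariationalVariance` at the trial function `f̄` reads
`σ²_f ≥ 2 (Var_π f)²/𝓔(f̄) − Var_π f`, hence **`σ²_f ≥ r/(1 − r) · Var_π f`**, i.e.
`τ_int,f ≥ r/(2(1 − r))` for EVERY bounded observable: a sampler that rejects (or otherwise holds) with
probability at least `r` everywhere cannot decorrelate anything faster than the two-state chain with
that holding probability.  Reading for the cell (value-free): a certified acceptance CEILING `1 − r` of
an HMC / Metropolis arm is at once a certified `τ_int` FLOOR `r/(2(1−r))` for all its observables.
Printed counterparts NAMED ONLY: lag-one / rejection bounds for Metropolis–Hastings chains (Peskun 1973;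
Liu 1996 for the independence sampler — the tree's `Exactness/IMHStickingFloor*` files are the IMH
case with the exact sticking structure) — nothing is cited as a fact.

## Content (`[MeasurableSingletonClass Ω]`; `π` invariant; `|f| ≤ C` measurable, `f̄ = f − πf`)

* **`kopDirichlet_le_of_holding`** — `κ(x,{x}) ≥ r` for all `x` `⇒ ∫ f̄ (f̄ − kop κ f̄) dπ ≤ 2 (1 − r) ∫ f̄² dπ`;
  **`autocov_one_ge_of_holding`** — `∫ f̄ · kop κ f̄ dπ ≥ (2r − 1) ∫ f̄² dπ`;
* **`greenKubo_ge_holding_of_isReversible`** — reversible + envelope, `r < 1`: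
  `r/(1 − r) · ∫ f̄² dπ ≤ σ²_f`.

NOT CLAIMED: a floor from the MEAN acceptance alone in `L²` terms (the budget form of
`Scoring/ReversibleVarianceJumpFloor` covers state-dependent bounds with a sup-norm factor);
non-reversible kernels for (2); unbounded observables; any `r` of a concrete sampler; any number of ours.
-/

noncomputable section

namespace Summit.Ventures.LatticeQCDFlow.Scoring

open MeasureTheory ProbabilityTheory Filter Finset Preorder Literature.Probability.MarkovChains
open scoped ENNReal Topology

variable {Ω : Type*} [MeasurableSpace Ω] [MeasurableSingletonClass Ω]

section Holding

variable (κ : Kernel Ω Ω) [IsMarkovKernel κ] {π : Measure Ω} [IsProbabilityMeasure π]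

/-- **UNIFORM HOLDING `⇒ 𝓔(g) ≤ 2(1 − r) ∫ g² dπ`**: if `ENNReal.ofReal r ≤ κ(x, {x})` for every `x`,
then `∫ g (g − kop κ g) dπ ≤ 2 (1 − r) ∫ g² dπ` for every bounded measurable `g` (`π`
invariant; the Dirichlet form is half the mean squared jump, the jump integrand vanishes on the diagonal,
`(a − b)² ≤ 2a² + 2b²`, and `∫ kop κ (g²) dπ = ∫ g² dπ`). -/
theorem kopDirichlet_le_of_holding (hπ : Kernel.Invariant κ π) {r : ℝ}
    (hhold : ∀ x, ENNReal.ofReal r ≤ (κ x) {x})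
    {g : Ω → ℝ} (hg : Measurable g) {Cg : ℝ} (hCg : ∀ x, |g x| ≤ Cg) :
    ∫ x, g x * (g x - kop κ g x) ∂π ≤ 2 * (1 - r) * ∫ x, g x ^ 2 ∂π := by
  rw [kopDirichlet_eq_half_meanSqJump κ hπ hg hCg]
  have hg2 : Measurable fun y => g y ^ 2 := hg.pow_const 2
  have hCg2 : ∀ y, |g y ^ 2| ≤ Cg ^ 2 := fun y => by
    rw [abs_pow]; exact pow_le_pow_left₀ (abs_nonneg _) (hCg y) 2
  -- the move probability is at most `1 − r`
  have hmove : ∀ x, ((κ x) {x}ᶜ).toReal ≤ 1 - r := fun x => by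
    have hc := prob_compl_eq_one_sub (μ := κ x) (measurableSet_singleton x)
    rw [hc, ENNReal.toReal_sub_of_le prob_le_one ENNReal.one_ne_top, ENNReal.toReal_one]
    have : r ≤ ((κ x) {x}).toReal := by
      rcases le_or_gt 0 r with hr0 | hr0
      · have h := (ENNReal.ofReal_le_iff_le_toReal (measure_ne_top (κ x) {x})).1 (hhold x)
        exact h
      · exact hr0.le.trans ENNReal.toReal_nonneg
    linarith
  -- pointwise: `∫ (g y − g x)² dκx ≤ 4 g(x)² (1 − r) + 2 (K(g²)(x) − g(x)²)`
  have hpt : ∀ x, ∫ y, (g y - g x) ^ 2 ∂(κ x)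
      ≤ 4 * (1 - r) * g x ^ 2 + 2 * (kop κ (fun y => g y ^ 2) x - g x ^ 2) := by
    intro x
    have hS : MeasurableSet ({x}ᶜ : Set Ω) := (measurableSet_singleton x).compl
    have hvan : ∫ y, (g y - g x) ^ 2 ∂(κ x) = ∫ y in {x}ᶜ, (g y - g x) ^ 2 ∂(κ x) := by
      rw [← integral_indicator hS]
      refine integral_congr_ae (ae_of_all _ fun y => ?_)
      by_cases hy : y = x
      · subst hy; simp
      · rw [Set.indicator_of_mem (by simpa using hy)]
    have hφb : ∀ y, |(g y - g x) ^ 2| ≤ (Cg + Cg) ^ 2 := fun y => by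
      rw [abs_pow]
      exact pow_le_pow_left₀ (abs_nonneg _) ((abs_sub _ _).trans (add_le_add (hCg y) (hCg x))) 2
    have hiφ : Integrable (fun y => (g y - g x) ^ 2) (κ x) :=
      integrable_of_bounded _ ((hg.sub_const _).pow_const 2) hφb
    have hig2x : Integrable (fun y => g y ^ 2) (κ x) := integrable_of_bounded _ hg2 hCg2
    have hi2 : Integrable (fun y => 2 * g y ^ 2 + 2 * g x ^ 2) (κ x) :=
      (hig2x.const_mul 2).add (integrable_const _)
    have hle : ∫ y in {x}ᶜ, (g y - g x) ^ 2 ∂(κ x) ≤ ∫ y in {x}ᶜ, (2 * g y ^ 2 + 2 * g x ^ 2) ∂(κ x) :=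
      setIntegral_mono_ae hiφ.integrableOn hi2.integrableOn (ae_of_all _ fun y => by
        nlinarith [sq_nonneg (g y + g x)])
    -- `∫_{ {x}ᶜ } g² dκx ≤ K(g²)(x) − g(x)² r` and `∫_{ {x}ᶜ } g(x)² dκx = g(x)² κ(x,{x}ᶜ) ≤ g(x)² (1−r)`
    have h1 := integral_add_compl (μ := κ x) (measurableSet_singleton x) hig2x
    have hsing : ∫ y in ({x} : Set Ω), g y ^ 2 ∂(κ x) = ((κ x) {x}).toReal * g x ^ 2 := by
      rw [Measure.restrict_singleton, integral_smul_measure, integral_dirac, smul_eq_mul]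
    have hKx : ∫ y, g y ^ 2 ∂(κ x) = kop κ (fun y => g y ^ 2) x := rfl
    have hrx : r * g x ^ 2 ≤ ((κ x) {x}).toReal * g x ^ 2 := by
      refine mul_le_mul_of_nonneg_right ?_ (sq_nonneg _)
      have := hmove x
      have hc := prob_compl_eq_one_sub (μ := κ x) (measurableSet_singleton x)
      rw [hc, ENNReal.toReal_sub_of_le prob_le_one ENNReal.one_ne_top, ENNReal.toReal_one] at this
      linarith
    have hrest : ∫ y in {x}ᶜ, (2 * g y ^ 2 + 2 * g x ^ 2) ∂(κ x)
        = 2 * ∫ y in {x}ᶜ, g y ^ 2 ∂(κ x) + 2 * g x ^ 2 * ((κ x) {x}ᶜ).toReal := by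
      rw [integral_add (hig2x.const_mul 2).integrableOn (integrable_const _).integrableOn,
        integral_const_mul, setIntegral_const, smul_eq_mul, Measure.real]
      ring
    rw [hvan]
    calc ∫ y in {x}ᶜ, (g y - g x) ^ 2 ∂(κ x) ≤ _ := hle
      _ = 2 * ∫ y in {x}ᶜ, g y ^ 2 ∂(κ x) + 2 * g x ^ 2 * ((κ x) {x}ᶜ).toReal := hrest
      _ ≤ 2 * (kop κ (fun y => g y ^ 2) x - r * g x ^ 2) + 2 * g x ^ 2 * (1 - r) := by
          have hA : ∫ y in {x}ᶜ, g y ^ 2 ∂(κ x) ≤ kop κ (fun y => g y ^ 2) x - r * g x ^ 2 := by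
            linarith [h1, hsing, hKx, hrx]
          have hB : 2 * g x ^ 2 * ((κ x) {x}ᶜ).toReal ≤ 2 * g x ^ 2 * (1 - r) :=
            mul_le_mul_of_nonneg_left (hmove x) (by positivity)
          linarith
      _ = 4 * (1 - r) * g x ^ 2 + 2 * (kop κ (fun y => g y ^ 2) x - g x ^ 2) := by ring
  -- integrate in `x`: `∫ K(g²) dπ = ∫ g² dπ` kills the second term
  have hiK : Integrable (fun x => kop κ (fun y => g y ^ 2) x) π :=
    integrable_of_bounded π (measurable_kop κ hg2) (abs_kop_le κ hCg2)
  have hig2 : Integrable (fun x => g x ^ 2) π := integrable_of_bounded π hg2 hCg2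
  have hF : Measurable fun x => ∫ y, (g y - g x) ^ 2 ∂(κ x) := by
    have hF : Measurable (Function.uncurry fun (x y : Ω) => (g y - g x) ^ 2) :=
      ((hg.comp measurable_snd).sub (hg.comp measurable_fst)).pow_const 2
    exact (hF.stronglyMeasurable.integral_kernel_prod_right' (κ := κ)).measurable
  have hFb : ∀ x, |∫ y, (g y - g x) ^ 2 ∂(κ x)| ≤ (Cg + Cg) ^ 2 := fun x => by
    rw [abs_of_nonneg (integral_nonneg fun y => sq_nonneg _)]
    calc ∫ y, (g y - g x) ^ 2 ∂(κ x) ≤ ∫ _y, (Cg + Cg) ^ 2 ∂(κ x) :=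
          integral_mono_of_nonneg (ae_of_all _ fun y => sq_nonneg _) (integrable_const _)
            (ae_of_all _ fun y => by
              calc (g y - g x) ^ 2 = |g y - g x| ^ 2 := (sq_abs _).symm
                _ ≤ (Cg + Cg) ^ 2 := pow_le_pow_left₀ (abs_nonneg _)
                    ((abs_sub _ _).trans (add_le_add (hCg y) (hCg x))) 2)
      _ = (Cg + Cg) ^ 2 := by rw [integral_const, probReal_univ, one_smul]
  have hiA : Integrable (fun x => 4 * (1 - r) * g x ^ 2) π := hig2.const_mul _
  have hiB : Integrable (fun x => 2 * (kop κ (fun y => g y ^ 2) x - g x ^ 2)) π := (hiK.sub hig2).const_mul 2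
  have hiAB : Integrable (fun x => 4 * (1 - r) * g x ^ 2 + 2 * (kop κ (fun y => g y ^ 2) x - g x ^ 2)) π :=
    hiA.add hiB
  have hint := integral_mono (integrable_of_bounded π hF hFb) hiAB hpt
  rw [integral_add hiA hiB, integral_const_mul, integral_const_mul, integral_sub hiK hig2,
    integral_kop κ hπ hg2 hCg2, sub_self, mul_zero, add_zero] at hint
  linarith

/-- **`C(1) ≥ (2r − 1) · C(0)`**: under a uniform holding bound the lag-one stationary autocovariance of
every bounded measurable `g` obeys `∫ g · kop κ g dπ ≥ (2r − 1) ∫ g² dπ` (`π` invariant). -/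
theorem autocov_one_ge_of_holding (hπ : Kernel.Invariant κ π) {r : ℝ}
    (hhold : ∀ x, ENNReal.ofReal r ≤ (κ x) {x})
    {g : Ω → ℝ} (hg : Measurable g) {Cg : ℝ} (hCg : ∀ x, |g x| ≤ Cg) :
    (2 * r - 1) * ∫ x, g x ^ 2 ∂π ≤ ∫ x, g x * kop κ g x ∂π := by
  have h := kopDirichlet_le_of_holding κ hπ hhold hg hCg
  have hig2 : Integrable (fun x => g x ^ 2) π :=
    integrable_of_bounded π (hg.pow_const 2) (C := Cg ^ 2) fun y => by
      rw [abs_pow]; exact pow_le_pow_left₀ (abs_nonneg _) (hCg y) 2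
  have higK : Integrable (fun x => g x * kop κ g x) π :=
    integrable_of_bounded π (hg.mul (measurable_kop κ hg)) (C := |Cg| * Cg) fun x => by
      rw [abs_mul]
      exact mul_le_mul ((hCg x).trans (le_abs_self _)) (abs_kop_le κ hCg x) (abs_nonneg _) (abs_nonneg _)
  have e : ∫ x, g x * (g x - kop κ g x) ∂π = ∫ x, g x ^ 2 ∂π - ∫ x, g x * kop κ g x ∂π := by
    rw [← integral_sub hig2 higK]
    exact integral_congr_ae (ae_of_all _ fun x => by ring)
  rw [e] at h
  linarith

end Holding

section Reversible

variable {κ : Kernel Ω Ω} [IsMarkovKernel κ] {π : Measure Ω} [IsProbabilityMeasure π] {A ρ : ℝ}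

/-- **THE HOLDING FLOOR.**  `κ` `π`-reversible with the geometric envelope (`0 ≤ ρ < 1`), a uniform
holding bound `ENNReal.ofReal r ≤ κ(x, {x})` with `r < 1`, `|f| ≤ C` measurable:
`r/(1 − r) · Var_π f ≤ σ²_f`, i.e. `τ_int,f ≥ r/(2(1 − r))` for EVERY bounded observable. -/
theorem greenKubo_ge_holding_of_isReversible (hrev : Kernel.IsReversible κ π)
    (henv : ∀ (g : Ω → ℝ), Measurable g → ∀ (Cg : ℝ), (∀ x, |g x| ≤ Cg) →
      ∀ (t : ℕ) (x : Ω), |(kop κ)^[t] g x - ∫ y, g y ∂π| ≤ 2 * Cg * (A * ρ ^ t))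
    (hρ0 : 0 ≤ ρ) (hρ1 : ρ < 1) {r : ℝ} (hr1 : r < 1)
    (hhold : ∀ x, ENNReal.ofReal r ≤ (κ x) {x})
    {f : Ω → ℝ} (hf : Measurable f) {C : ℝ} (hC : ∀ x, |f x| ≤ C) :
    r / (1 - r) * ∫ y, (f y - ∫ z, f z ∂π) ^ 2 ∂π
      ≤ (∫ y, (f y - ∫ z, f z ∂π) ^ 2 ∂π)
        + 2 * ∑' k, ∫ y, (f y - ∫ z, f z ∂π) * (kop κ)^[k + 1] (fun y => f y - ∫ z, f z ∂π) y ∂π := by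
  have hπ : Kernel.Invariant κ π := hrev.invariant
  obtain ⟨hfb, hCfb, -⟩ := centred_observable_bounds π hf hC
  set v := ∫ y, (f y - ∫ z, f z ∂π) ^ 2 ∂π with hv
  set E := ∫ y, (f y - ∫ z, f z ∂π) * ((f y - ∫ z, f z ∂π) - kop κ (fun z => f z - ∫ u, f u ∂π) y) ∂π
    with hEdef
  have hv0 : 0 ≤ v := integral_nonneg fun y => sq_nonneg _
  have h1r : 0 < 1 - r := sub_pos.2 hr1
  have hE : E ≤ 2 * (1 - r) * v := kopDirichlet_le_of_holding κ hπ hhold hfb hCfb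
  have hσ0 := greenKubo_nonneg_of_envelope hπ henv hρ0 hρ1 hf hC
  rcases hv0.eq_or_lt with hvz | hvpos
  · have h0 : r / (1 - r) * v = 0 := by rw [← hvz, mul_zero]
    rw [h0]; exact hσ0
  rcases le_or_gt r 0 with hr0 | hr0
  · -- `r ≤ 0`: the left side is nonpositive
    have : r / (1 - r) * v ≤ 0 :=
      mul_nonpos_of_nonpos_of_nonneg (div_nonpos_of_nonpos_of_nonneg hr0 h1r.le) hv0
    linarith
  -- `E > 0` (else `v ≤ 0` from the variational bound at large multiples — use the positive case directly)
  have hEpos : 0 < E := by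
    by_contra hle
    have hE0 : E = 0 := le_antisymm (not_lt.1 hle) (kopDirichlet_nonneg κ hπ hfb hCfb)
    -- with `E = 0` the variational bound at `c · f̄` gives `4 c v − v ≤ σ²` for every `c`: impossible, `v > 0`
    have hcg := fun c : ℝ =>
      greenKubo_ge_variational_of_isReversible hrev henv hρ0 hρ1 hf hC (hfb.const_mul c)
        (Cg := |c| * (2 * C)) (fun x => by rw [abs_mul]; exact mul_le_mul_of_nonneg_left (hCfb x) (abs_nonneg _))
    set σ2 := v + 2 * ∑' k, ∫ y, (f y - ∫ z, f z ∂π)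
        * (kop κ)^[k + 1] (fun y => f y - ∫ z, f z ∂π) y ∂π
    have hKc : ∀ (c : ℝ) y, kop κ (fun z => c * (f z - ∫ u, f u ∂π)) y
        = c * kop κ (fun z => f z - ∫ u, f u ∂π) y := fun c y => by
      unfold kop; exact integral_const_mul c _
    have key : ∀ c : ℝ, 4 * (c * v) - v ≤ σ2 := by
      intro c
      have h := hcg c
      have e1 : ∫ y, (f y - ∫ z, f z ∂π) * (c * (f y - ∫ z, f z ∂π)) ∂π = c * v := by
        rw [hv, ← integral_const_mul]; exact integral_congr_ae (ae_of_all _ fun y => by ring)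
      have e2 : ∫ y, (c * (f y - ∫ z, f z ∂π)) * ((c * (f y - ∫ z, f z ∂π))
          - kop κ (fun z => c * (f z - ∫ u, f u ∂π)) y) ∂π = c ^ 2 * E := by
        rw [hEdef, ← integral_const_mul]
        exact integral_congr_ae (ae_of_all _ fun y => by simp only [hKc c y]; ring)
      rw [e1, e2, hE0, mul_zero, mul_zero, sub_zero] at h
      exact h
    have h := key ((σ2 + v + 1) / (4 * v))
    have e : 4 * ((σ2 + v + 1) / (4 * v) * v) = σ2 + v + 1 := by field_simp
    rw [e] at h
    linarith
  have hmain := greenKubo_ge_overlap_sq_div_dirichlet_of_isReversible hrev henv hρ0 hρ1 hf hC hfb hCfb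
    hEpos
  have e1 : ∫ y, (f y - ∫ z, f z ∂π) * (f y - ∫ z, f z ∂π) ∂π = v := by
    rw [hv]; exact integral_congr_ae (ae_of_all _ fun y => by ring)
  rw [e1] at hmain
  -- `2 v²/E − v ≥ 2v²/(2(1−r)v) − v = v/(1−r) − v = r v/(1−r)`
  have hcmp : r / (1 - r) * v ≤ 2 * v ^ 2 / E - v := by
    have h2 : v / (1 - r) ≤ 2 * v ^ 2 / E := by
      rw [div_le_div_iff₀ h1r hEpos]
      nlinarith [hE, hvpos]
    have e : r / (1 - r) * v = v / (1 - r) - v := by field_simp; ring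
    rw [e]; linarith
  linarith

end Reversible

end Summit.Ventures.LatticeQCDFlow.Scoring

end
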